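import Summits.PneNP.PneNP.Theses.Autoreducibility
import Literature.Computability.Complexity.Autoreducibility
import Literature.Computability.Complexity.ReductionsProofs

/-!
# Birth skeleton (BC3) — crux `TallyDiagonalBridge` (stmt-PneNP-15948), route `PneNP/Autoreducibility`

Crux decl `Summit.PneNP.PneNP.Theses.Autoreducibility.TallyDiagonalBridge` (the route's bridge, rank 9 → crux):

  `NP ⊆ P → ∃ A ∈ EXP, (∀ K ∈ EXP, ∃ Q ∈ FP, ∃ D ∈ P, K = ttLang Q (C 3) D A) ∧
     ¬ ∃ Q ∈ FP, ∃ q, ∃ D ∈ P, (∀ x, ∀ i < q(|x|), Q⟨x,1ⁱ⟩ ≠ x) ∧ ∀ n, (0ⁿ ∈ A ↔ 0ⁿ ∈ ttLang Q q D A)`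

— under `NP ⊆ P` some `≤ᵖ_{3-tt}`-hard set for `EXP` lying in `EXP` admits NO polynomial-time
self-avoiding nonadaptive query scheme that is correct on all tally inputs `0ⁿ`.

## The line: BFvMT Lemma 3.5 with the QBF-decider abstracted, diagonalizing on the tally inputs

Source: the 2001 archive paper (route exp-truth-table-autoreducibility, v7), §3: Lemma `elim`
(= Buhrman–Fortnow–van Melkebeek–Torenvliet 2000, Lemma 5.2: under `P = NP` closed prenex QBFs of
size `s` with `b` quantifier blocks are decidable in time `s^{(3c+1)^b}` by ONE machine) and
Theorem A(i) (= BFvMT Lemma 3.5, the stage-wise diagonalization with two coding regions, plus the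
time analysis putting the diagonal set into `DTIME(2^{n³})`). The observation that makes the TALLY
form direct: Lemma 3.5 diagonalizes against the `i`-th clocked nonadaptive self-avoiding scheme ONLY
on the single input `0^{n_i}` (`A(0^m) = 1 - M_i^A(0^m)`), so the constructed `A` defeats every
polynomial-time self-avoiding scheme AT A TALLY INPUT — exactly `¬ TallyScheme A` below; the
detour through prop:onebit (autoreducible off `{0^{n_i}}`) + patching is not needed.

The collapse hypothesis is consumed through ONE interface stated over `P` alone:

* `UniformAltElim` — *uniform alternation elimination*: for every matrix language `V ∈ P` there are
  constants `c, k` and ONE language `L ∈ P` deciding the bitwise prenex alternation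
  `AltVal V x acc qs` (`qs` = quantifier string, `true` = ∀, `false` = ∃; chosen bits appended to
  `acc`; matrix `⟨x, acc⟩ ∈ V`) on instances padded to length `(|x|+|acc|+|qs|+2)^(k·c^{blocks qs})`,
  `blocks qs` = number of maximal quantifier blocks. (Semantic matrices instead of `PrenexQBF`
  syntax: the diagonalizer's matrix "the clocked evaluator accepts `⟨0^m, answer bits⟩`" is a
  `P`-predicate, so no Cook–Levin translation is needed on either side.)

Stubs (the file's ONLY sorries):

* `stub_uniformElim` (size L; archive Lemma elim / BFvMT Lemma 5.2): `NP ⊆ P → UniformAltElim`.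
  Intended proof: `NU = {⟨e,⟨w,1ᴺ⟩⟩ | ∃ y, |y| ≤ N, ⟨e,⟨⟨w,y⟩,1ᴺ⟩⟩ ∈ U}` (`U` = the clocked
  universal acceptance language, `clockedUniversalAcceptance_holds`) is in `NP ⊆ P`, say in
  `DTIME(n^c)`; eliminate the innermost maximal block by ONE `NU`-membership (`∃`-block) or its
  negation (`∀`-block: `∀z φ(z) ⟺ ¬∃z ¬φ(z)`), with a FIXED pair of machine codes (base: run the
  `V`-decider on `⟨x, acc ++ z⟩`; step: run the `NU`-decider on the coded instance with the block
  appended and negate), budgets `N_{j+1} = poly(N_j)^c`; after `b` steps run the `NU`-decider once: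
  time `s^{O(c)^b}` ≤ the padding. Why it might fail: only by mis-typing (the padding exponent
  `k·c^b` with `c, k` existential absorbs every polynomial overhead); `UniformAltElim` at one
  `∃`-block gives back `NP ⊆ P`, so the stub is an honest "collapse ⇒ uniform collapse" theorem.
* `stub_expComplete` (size M/L; folklore, Arora–Barak 2009 §2.6 / Thm 1.9): `EXP` has a
  Karp-complete language, e.g. `K₁ = {⟨e,⟨w,1^m⟩⟩ | ⟨e,⟨w,1^{2^m}⟩⟩ ∈ U}` (`U ∈ P` clocked universal
  acceptance; membership in `EXP` by the exponential pad of `ExpPadding.lean`; hardness: a language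
  in `DTIME(2^{n^k})` reduces with `m = |w|^{k+1}`, finitely many short inputs by table). Not in the
  tree (`MetaComplexity/RefuterExpClosure.lean` takes `IsComplete EXP B` as a hypothesis).
* `stub_diagonal` (size XL; BFvMT Lemma 3.5 + archive Thm A(i)): `UniformAltElim → ∀ K ∈ EXP,
  ∃ A ∈ EXP, K ≤ᵖ_{3-tt} A ∧ ¬ TallyScheme A`. Stages `n_{i+1} = n_i^{β(n_i)}+1`, candidate
  schemes = codes `(e_Q, e_D, q, j)` clocked to `n^j` via the tree's clocked universal
  simulation/acceptance, each recurring infinitely often; stage `i` (input `0^m`, `m = n_i`) decides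
  the alternating statement (2) of the paper — `(∀ℓ_{I₀})(∃r_{I₀})⋯(∀ℓ_{I_J})(∃r_{I_J}) [M_i^{A'}(0^m) accepts]`,
  `2(J+1) = O(log β(m))` blocks of the squaring length-ranges `[m^{2^j}, m^{2^{j+1}})` — through `L`
  of `UniformAltElim` (matrix `V ∈ P`: table lookup + clocked acceptance; prefix-fixing = the `acc`
  argument, used for the lexicographically-first fillings), sets `A(0^m)` opposite to the forced
  verdict, lets the left/right region carry `K` (`K(y) = A(⟨A(0^{n(y)}), y⟩)`, the 3-query
  tt-reduction: queries `0^{n(y)}, ⟨0,y⟩, ⟨1,y⟩`), and `A ∈ EXP`: cost `2^m · t_K(m²) ·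
  (s+2)^{k c^b}` with `s = m^{O(β(m))}`, `b = O(log β(m))`, i.e. `m^{β(m)^{O(1)}} = 2^{o(m)}` for
  `β(m) ≤ log m` — ANY constants `c, k` are absorbed, which is why the abstract interface suffices.
  Why it might fail: model plumbing only (an honest `EXP` machine for `A` — use `padLang`/`P` and
  `mem_EXP_of_padLang_mem_P`; poly-time computability of `y ↦ n(y)`; the clocked enumeration must
  carry the query-count polynomial `q` so the simulated evaluator sees exactly `q(m)` answer bits).

Assembly (sorry-free): `polyTimeBddTTReducible_of_karp` (Karp ∘ `k`-tt = `k`-tt, the composition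
`Autoreducibility.lean` lists as not vendored; constant query count makes it elementary) and
`tallyDiagonalBridge_of_sigs : <stub₁-sig> → <stub₂-sig> → <stub₃-sig> → <body of the crux>`;
`TallyDiagonalBridge_of : TallyDiagonalBridge` concludes the crux BY NAME from the three stubs.

Disproof used: none exists (`ledger crux ls stmt-PneNP-15948`: no workfiles at registration,
2026-08-17). Negatives index (PneNP): no refuted statement concerns autoreducibility / complete
degrees; no stub is an instance of a landed Negative lemma.

BC3 probes (planner folder `bc/*_probe.lean`): for each stub `S`, `S → TallyDiagonalBridge` and
`S → PneNP` by `first | exact? | simpa | aesop` FAIL (see the probe files and NOTES.md for the raw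
verdicts); no stub is cheaply the crux or the summit.

References: H. Buhrman, L. Fortnow, D. van Melkebeek, L. Torenvliet, *Separating complexity classes
using autoreducibility*, SIAM J. Comput. 29 (2000) 1497–1520, Lemma 3.5, Lemma 5.2, Fig. 7 q.4
[BuhrmanEtAl2000]; H. Buhrman, L. Torenvliet, *A Post's program for complexity theory*, Bull.
EATCS 85 (2005) [BuhrmanTorenvliet2005]; S. Arora, B. Barak, *Computational Complexity* (2009),
Thm 1.9, §2.6, Thm 5.4 [AroraBarakCC2009]; the 2001 archive route exp-truth-table-autoreducibility,
paper v7 §§2–3 (Lemma elim, Thm A(i)), §ae (prop:onebit).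
-/

set_option linter.dupNamespace false -- `Summit.PneNP.PneNP.…` is the layout-mandated namespace

namespace Summit.PneNP.PneNP.Cruxes.TallyDiagonalBridge.Birth

open Literature.Computability.Complexity
open Literature.Computability.Complexity.PRelSigma

/-! ## The interface -/

/-- **Bitwise prenex alternation over a `P`-matrix.** `AltVal V x acc qs`: quantify the remaining
variables `qs` one Boolean at a time (`true` = ∀, `false` = ∃), appending each chosen bit to the
accumulator `acc`, and evaluate the matrix `⟨x, acc⟩ ∈ V` when `qs` is exhausted. (The semantic
form of a closed prenex QBF whose matrix is a polynomial-time predicate of the input `x` and the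
quantified bits; Arora–Barak 2009, Def. 5.3 / Thm 5.4, iterated.) -/
def AltVal (V : Language Bool) (x : List Bool) : List Bool → List Bool → Prop
  | acc, [] => boolPair x acc ∈ V
  | acc, true :: qs => ∀ b : Bool, AltVal V x (acc ++ [b]) qs
  | acc, false :: qs => ∃ b : Bool, AltVal V x (acc ++ [b]) qs

/-- The number of maximal constant runs (quantifier BLOCKS) of a quantifier string:
`blocks [] = 0`, `blocks [∀,∀,∃,∃,∃,∀] = 3`. -/
def blocks : List Bool → ℕ
  | [] => 0
  | [_] => 1
  | a :: b :: qs => (if a = b then 0 else 1) + blocks (b :: qs)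

/-- **Uniform alternation elimination** (the abstract form of "one machine decides closed prenex
QBFs of size `s` with `b` blocks in time `s^{O(1)^b}`", BFvMT Lemma 5.2 / archive Lemma elim):
for every matrix `V ∈ P` there are constants `c k` and ONE language `L ∈ P` such that, whenever the
pad length `N` is at least `(|x| + |acc| + |qs| + 2) ^ (k * c ^ blocks qs)`,
`⟨⟨x, acc⟩, ⟨qs, 1ᴺ⟩⟩ ∈ L ↔ AltVal V x acc qs`. (At a single `∃`-block this already says
`NP ⊆ P`; it follows from `NP ⊆ P` by iterated block elimination — `stub_uniformElim`.) -/
def UniformAltElim : Prop :=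
  ∀ V ∈ Classes.P, ∃ c k : ℕ, ∃ L ∈ Classes.P, ∀ (x acc qs : List Bool) (N : ℕ),
    (x.length + acc.length + qs.length + 2) ^ (k * c ^ blocks qs) ≤ N →
      (boolPair (boolPair x acc) (boolPair qs (List.replicate N true)) ∈ L ↔ AltVal V x acc qs)

/-- **A tally-correct self-avoiding nonadaptive query scheme for `A`** — verbatim the existential
the crux negates: `Q ∈ FP`, a query-count polynomial `q`, an evaluator `D ∈ P`, self-avoidance
`Q ⟨x, 1ⁱ⟩ ≠ x` for `i < q(|x|)`, and correctness `0ⁿ ∈ A ↔ 0ⁿ ∈ ttLang Q q D A` on every tally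
input. [BuhrmanEtAl2000, Def. 2.1 (nonadaptive autoreduction), restricted to `0*`] -/
def TallyScheme (A : Language Bool) : Prop :=
  ∃ Q ∈ FP, ∃ q : Polynomial ℕ, ∃ D ∈ Classes.P,
    (∀ x : List Bool, ∀ i < q.eval x.length, Q (boolPair x (List.replicate i true)) ≠ x) ∧
      ∀ n : ℕ, (List.replicate n false ∈ A ↔ List.replicate n false ∈ ttLang Q q D A)

/-! ## The registered stubs -/

/-- **Stub 1 (size L) — uniform alternation elimination from the collapse** (archive Lemma `elim`;
Buhrman–Fortnow–van Melkebeek–Torenvliet 2000, Lemma 5.2; Arora–Barak 2009, Thm 5.4 made uniform):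
if `NP ⊆ P` then `UniformAltElim`. Proof plan: the clocked universal acceptance language `U ∈ P`
(`clockedUniversalAcceptance_holds`) gives `NU = {⟨e,⟨w,1ᴺ⟩⟩ | ∃ y, |y| ≤ N ∧ ⟨e,⟨⟨w,y⟩,1ᴺ⟩⟩ ∈ U}
∈ NP ⊆ P`; peel maximal blocks from the inside with two FIXED machine codes (base = the
`V`-decider, step = "decide the coded `NU`-instance with the block appended, negate"), budgets
`N_{j+1} = poly(N_j)`, and run the `NU`-decider once at the end; the padding `(s+2)^(k·c^b)` pays.
Why it might fail: mis-typing only (at one `∃`-block the statement returns `NP ⊆ P`).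
Sources: BuhrmanEtAl2000 Lemma 5.2; archive paper v7 Lemma elim + Remark iterates; AroraBarakCC2009 Thm 5.4. -/
theorem stub_uniformElim :
    Nondeterministic.NP ⊆ Classes.P → UniformAltElim := by
  sorry

/-- **Stub 2 (size M/L) — `EXP` has a Karp-complete language** (folklore; Arora–Barak 2009, §2.6.2
with Thm 1.9: bounded halting). Witness plan: `K₁ = {⟨e,⟨w,1^m⟩⟩ | ⟨e,⟨w,1^{2^m}⟩⟩ ∈ U}` with `U`
the clocked universal acceptance language (`ClockedUniversalAcceptanceProofs.lean`): in `EXP` by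
the exponential pad (`ExpPadding.lean`, `exists_timeComputable_expPad`) followed by the `P`-decider
of `U`; hard for `DTIME(2^{n^k})` via `w ↦ ⟨e_M,⟨w,1^{|w|^{k+1}}⟩⟩` (completeness/soundness of `U`;
finitely many short inputs by a table). Why it might fail: it cannot mathematically; the cost is
machine plumbing. Not yet in the tree (`RefuterExpClosure.lean` assumes `IsComplete EXP B`).
Sources: AroraBarakCC2009 §2.6.2, Thm 1.9; clockedUniversalAcceptance_holds. -/
theorem stub_expComplete : ∃ K : Language Bool, IsComplete EXP K := by
  sorry

/-- **Stub 3 (size XL) — the tally diagonalization** (Buhrman–Fortnow–van Melkebeek–Torenvliet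
2000, Lemma 3.5, with the `TQBF`-machine hypothesis replaced by `UniformAltElim`; time analysis of
the archive's Thm A(i)): from uniform alternation elimination, every `K ∈ EXP` is `≤ᵖ_{3-tt}`-reducible
to some `A ∈ EXP` that has NO tally-correct self-avoiding nonadaptive query scheme. Construction:
stages `n_{i+1} = n_i^{β(n_i)} + 1` (`β` slowly growing, e.g. `β(m) ≤ log m`); stage `i` diagonalizes
at the single input `0^{n_i}` against the `i`-th clocked candidate `(e_Q, e_D, q, j)` (clocked
universal simulation / acceptance, every code recurring infinitely often), deciding the alternating
statement `(∀ℓ_{I₀})(∃r_{I₀})⋯(∀ℓ_{I_J})(∃r_{I_J}) [clocked evaluator accepts ⟨0^m, answer bits of A'⟩]`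
(`O(log β(m))` blocks over the squaring length-ranges) by the language `L` of `UniformAltElim`
(matrix in `P`: table lookup + clocked acceptance; lexicographically-first fillings by prefix-fixing
through `acc`); `K(y) = A(⟨A(0^{n(y)}), y⟩)` is the 3-query reduction (queries `0^{n(y)}`, `⟨0,y⟩`,
`⟨1,y⟩`); `A ∈ EXP` since `2^m · t_K(m²) · (s+2)^(k·c^b) = 2^{poly(m)}` for `s = m^{O(β(m))}`,
`b = O(log β(m))`, whatever the constants `c, k`. Why it might fail: model plumbing (an honest `EXP`
bound for `A` — go through `padLang`/`mem_EXP_of_padLang_mem_P`; `y ↦ n(y)` in `FP`; the candidate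
code must carry `q` so the simulated evaluator sees exactly `q(m)` answer bits); the mathematics is
BFvMT's. Sources: BuhrmanEtAl2000 Lemma 3.5, Thm 5.3; archive paper v7 §2 (shape of the
construction), Thm A(i); BuhrmanTorenvliet2005. -/
theorem stub_diagonal :
    UniformAltElim → ∀ K ∈ EXP, ∃ A ∈ EXP, PolyTimeBddTTReducible 3 K A ∧ ¬ TallyScheme A := by
  sorry

/-! ## Assembly (sorry-free) -/

/-- Pre-composing the query generator with a Karp reduction `f` (read off the first component of
the coded pair `⟨x, 1ⁱ⟩`) asks the queries of `f x`. [folklore] -/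
theorem ttBits_comp_karp (Q f : List Bool → List Bool) (A : Language Bool) (x : List Bool) (n : ℕ) :
    ttBits (Q ∘ pairFn (f ∘ fstP) sndP) A x n = ttBits Q A (f x) n := by
  simp [ttBits]

/-- **Karp ∘ `k`-tt is `k`-tt**: if `K' ≤ₚ K` and `K ≤ᵖ_{k-tt} A` then `K' ≤ᵖ_{k-tt} A` — query
generator `Q ∘ (f × id)`, evaluator `(f × id)⁻¹(D)` (constant query count, so no re-indexing of the
answer list is needed). [Ladner–Lynch–Selman 1975, §3; folklore] -/
theorem polyTimeBddTTReducible_of_karp {k : ℕ} {K' K A : Language Bool}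
    (hK' : PolyTimeKarpReducible K' K) (hK : PolyTimeBddTTReducible k K A) :
    PolyTimeBddTTReducible k K' A := by
  obtain ⟨f, hf, hiff⟩ := hK'
  obtain ⟨Q, hQ, D, hD, hKeq⟩ := hK
  have hg : pairFn (f ∘ fstP) sndP ∈ FP :=
    pairFn_mem_FP (comp_mem_FP hf fstP_mem_FP) sndP_mem_FP
  refine ⟨Q ∘ pairFn (f ∘ fstP) sndP, comp_mem_FP hQ hg, pairFn (f ∘ fstP) sndP ⁻¹' D,
    preimage_mem_P hD hg, ?_⟩
  ext x
  have h1 : x ∈ K' ↔ f x ∈ K := hiff x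
  rw [h1, hKeq, mem_ttLang_iff, mem_ttLang_iff, memL_preimage, pairFn_apply, Function.comp_apply,
    fstP_boolPair, sndP_boolPair, ttBits_comp_karp, Polynomial.eval_C, Polynomial.eval_C]

/-- **ASSEMBLY (kernel-checked, no `sorry`).** The three stub statements imply the crux statement
(verbatim the body of `Summit.PneNP.PneNP.Theses.Autoreducibility.TallyDiagonalBridge`): under
`NP ⊆ P`, Stub 1 gives uniform alternation elimination, Stub 3 applied to the complete `K` of
Stub 2 gives `A ∈ EXP` with `K ≤ᵖ_{3-tt} A` and no tally scheme, and every `K' ∈ EXP` reaches `A`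
through `K' ≤ₚ K` (`polyTimeBddTTReducible_of_karp`). [BuhrmanEtAl2000, Thm 5.3 / Lemma 3.5] -/
theorem tallyDiagonalBridge_of_sigs
    (h₁ : Nondeterministic.NP ⊆ Classes.P → UniformAltElim)
    (h₂ : ∃ K : Language Bool, IsComplete EXP K)
    (h₃ : UniformAltElim → ∀ K ∈ EXP, ∃ A ∈ EXP, PolyTimeBddTTReducible 3 K A ∧ ¬ TallyScheme A) :
    Literature.Computability.Complexity.Nondeterministic.NP ⊆ Literature.Computability.Complexity.Classes.P →
      ∃ A ∈ Literature.Computability.Complexity.EXP,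
        (∀ K ∈ Literature.Computability.Complexity.EXP, ∃ Q ∈ Literature.Computability.Complexity.FP,
          ∃ D ∈ Literature.Computability.Complexity.Classes.P,
            K = Literature.Computability.Complexity.ttLang Q (Polynomial.C 3) D A) ∧
        ¬ ∃ Q ∈ Literature.Computability.Complexity.FP, ∃ q : Polynomial ℕ,
            ∃ D ∈ Literature.Computability.Complexity.Classes.P,
              (∀ x : List Bool, ∀ i < q.eval x.length,
                Q (Literature.Computability.Complexity.boolPair x (List.replicate i true)) ≠ x) ∧
              ∀ n : ℕ, (List.replicate n false ∈ A ↔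
                List.replicate n false ∈ Literature.Computability.Complexity.ttLang Q q D A) := by
  intro hNP
  obtain ⟨K, hKexp, hKhard⟩ := h₂
  obtain ⟨A, hA, hred, hno⟩ := h₃ (h₁ hNP) K hKexp
  refine ⟨A, hA, fun K' hK' => ?_, hno⟩
  obtain ⟨Q, hQ, D, hD, hEq⟩ := polyTimeBddTTReducible_of_karp (hKhard K' hK') hred
  exact ⟨Q, hQ, D, hD, hEq⟩

/-- **The crux BY NAME from the three declared stubs** (the file's only sorries are inside
`stub_uniformElim`, `stub_expComplete`, `stub_diagonal`). -/
theorem TallyDiagonalBridge_of : Summit.PneNP.PneNP.Theses.Autoreducibility.TallyDiagonalBridge :=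
  tallyDiagonalBridge_of_sigs stub_uniformElim stub_expComplete stub_diagonal

end Summit.PneNP.PneNP.Cruxes.TallyDiagonalBridge.Birth
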